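import Summits.Ventures.HSemireg.WedgePointPairPowersPerQRank

/-!
# Venture HSemireg — per-`q` blocks of the `n`-fold box of `m`-dimensional point pairs, companion: THE TWO EXTREME BLOCKS
# `q = 0` and `q = mn − k` have rank `C(mn, k)` — the full size of those blocks — for EVERY `m ≥ 1`, `n`, `k`

HONEST FRAMING. Part of the Lean index of the computation cell `pub-hsemireg` (seat p10 gen 4, Sunday typer «UNIFORM-IN-n»).
Finite-dimensional EXTERIOR ALGEBRA over a field and natural-number arithmetic ONLY: no variety, no cohomology theory, no sheaf, no
Ext group, no semiregularity map is constructed here; nothing here says that HC / HC_CM / HC_AV holds; no Literature fact is declared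
or used.  Custodian versions: STRUCTURE.md v1.0-SIGNED 9b196a05977dd067 (§1.1 C13), theory/FORMULA-N.md PART A §4.1″ (th-6) / PART B
§G (th-7).  Model and dictionary (quoted, NOT asserted): `WedgePointPairPowers.lean`; the per-`q` rank theorem
`WedgePointPairPowersPerQRank.finrank_range_blockProj_wedge_pairBox` (`rank_q = genCount m n k q = |Fset m n k q|`).

THIS FILE: the first and last entries of every per-`q` row in CLOSED FORM, uniformly in `n` AND `m`.  §0 block bookkeeping (`glue` /
`pb` are inverse; `XX`, `YY` = all `X`- / `Y`-letters, `|XX| = |YY| = mn`); §1 THE TOP BLOCK `q = mn − k`: a degree-`k`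
class reaches it iff EVERY block of its option data is an `X`-subset (`∅`, proper, or the top collapse `X`; local inequality
`q_f(o) + m·z(o) + |o| ≤ m` with equality iff `o ⊆ X`), and `f ↦ src f` is a bijection of those classes onto the `k`-subsets of `XX`
(`map_src_Fset_top`), so **`|Fset m n k (mn − k)| = C(mn, k)`**; §2 THE BOTTOM BLOCK `q = 0`: a class reaches it iff every block has
`q`-part `0` (`∅`, the top collapse `X`, or a proper `Y`-subset), and replacing `X` by `Y` blockwise (`toY`) is a bijection onto the
`k`-subsets of `YY` (`map_glueY_Fset_zero`), so **`|Fset m n k 0| = C(mn, k)`** (`m ≥ 1`); §3 THE RANK STATEMENTS for every field,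
`m ≥ 1`, `n`, `k`, `a, c ≠ 0`: **`rank(0-block of θ ↦ θ ∧ F ∣ ⋀^k) = rank((mn − k)-block) = C(mn, k)`**
(`finrank_range_blockProj_wedge_pairBox_zero` / `_top`) — the `9, 36, 84 = C(9, k)` opening the pre-registered `m = 3`, `n = 3` rows
and the `15 = C(6,2)`, `28 = C(8,2)`, `45 = C(10,2)` opening the surface rows `(15,24,27,24,15)`, …; §5 as arithmetic of p10's
enumerator: `genCount m n k 0 = genCount m n k (mn − k) = C(mn, k)`.  That `C(mn, k)` is also the NUMBER OF MONOMIALS of each extreme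
block in degree `k + mn` (so `θ ↦ θ ∧ F` is onto both) is the companion leaf `WedgePointPairPowersPerQExtremeOnto.lean`.
Namespace `Summit.Ventures.HSemireg.Wedge.PairPowers`, new names only (the letter count `|XX| = mn` enters as `|XX| = |YY| = mn` via the
new `YY`; the sibling leaf `WedgePointPairPowersPerQOverlap.lean`, which neither imports nor is imported here, has it as `card_XX`).
-/

open Module Set Set.powersetCard Polynomial

namespace Summit.Ventures.HSemireg.Wedge.PairPowers

open Summit.Ventures.HSemireg.Wedge Summit.Ventures.HSemireg.Wedge.Kunneth

variable (K : Type*) [Field K] {m : ℕ} {n : ℕ}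

/-! ## §0. Blocks: `glue` and `pb` are inverse; all `X`-letters, all `Y`-letters -/

/-- pull-back to a block is monotone. -/
lemma pb_mono {T T' : Finset (Fin ((m + m) * n))} (h : T ⊆ T') (i : Fin n) : pb m n i T ⊆ pb m n i T' :=
  fun _ hj => mem_pb.mpr (h (mem_pb.mp hj))

/-- a monomial is the gluing of its blocks. -/
lemma glue_pb (T : Finset (Fin ((m + m) * n))) : glue (fun i => pb m n i T) = T := by
  ext x
  rw [glue, Finset.mem_biUnion]
  constructor
  · rintro ⟨i, -, h⟩
    rw [lift_pb, Finset.mem_inter] at h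
    exact h.1
  · intro hx
    refine ⟨⟨x / (m + m), div_lt x⟩, Finset.mem_univ _, ?_⟩
    rw [lift_pb, Finset.mem_inter]
    exact ⟨hx, mem_D_div x⟩

/-- gluing is injective (block `i` of the glued monomial is `g i`). -/
lemma glue_injective : Function.Injective (glue (m := m) (n := n)) :=
  fun g g' h => funext fun i => by rw [← pb_glue g i, h, pb_glue]

/-- the glued monomial has `Σ_i |g i|` letters. -/
lemma card_glue (g : Fin n → Finset (Fin (m + m))) : (glue g).card = ∑ i, (g i).card := by
  rw [glue, Finset.card_biUnion]
  · exact Finset.sum_congr rfl fun i _ => card_lift i _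
  · intro i _ i' _ h
    exact disjoint_of_subsets (disjoint_D h) (lift_subset_D i _) (lift_subset_D i' _)

/-- inclusion of glued monomials is inclusion block by block. -/
lemma glue_subset_glue_iff {g g' : Fin n → Finset (Fin (m + m))} : glue g ⊆ glue g' ↔ ∀ i, g i ⊆ g' i := by
  constructor
  · intro h i
    rw [← pb_glue g i, ← pb_glue g' i]
    exact pb_mono h i
  · intro h x hx
    rw [glue, Finset.mem_biUnion] at hx ⊢
    obtain ⟨i, hi, hx⟩ := hx
    obtain ⟨j, hj, rfl⟩ := mem_lift.mp hx
    exact ⟨i, hi, mem_lift.mpr ⟨j, h i hj, rfl⟩⟩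

/-- all `X`-letters are the gluing of the `X` halves. -/
lemma XX_eq_glue : XX m n = glue fun _ : Fin n => Xs m := rfl

/-- the canonical source is the gluing of the chosen local sources. -/
lemma src_eq_glue (f : Fin n → Opt m) : src f = glue fun i => (f i).1 := rfl

variable (m n) in
/-- ALL `Y`-generators of `Fin ((m+m)n)`: the lifts of the `Y` halves. -/
def YY : Finset (Fin ((m + m) * n)) := glue fun _ : Fin n => Ys m

/-- the `Y`-generators number `mn`. -/
lemma card_YY : (YY m n).card = m * n := by
  rw [YY, card_glue, WedgePair.card_Yset, Finset.sum_const, Finset.card_univ, Fintype.card_fin, smul_eq_mul, mul_comm]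

/-- as many `X`-generators as `Y`-generators (so `mn` of each; the count `|XX| = mn` itself is the sibling leaf's `card_XX`, not
restated here). -/
lemma card_XX_eq_card_YY : (XX m n).card = (YY m n).card := by
  rw [card_YY, XX_eq_glue, card_glue, WedgePair.card_Xset, Finset.sum_const, Finset.card_univ, Fintype.card_fin, smul_eq_mul, mul_comm]

/-! ## §1. The top block `q = mn − k`: all blocks are `X`-subsets; `|Fset m n k (mn − k)| = C(mn, k)` -/

/-- the local quantity `q_f(o) + m·z(o) + |o|` of a canonical source. -/
def lval (o : Opt m) : ℕ := lqf m o + m * lz m o + (o.1).card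

/-- **`q_f(o) + m·z(o) + |o| ≤ m`, with equality iff the source is an `X`-subset** (`∅`: `0 + m + 0`; a non-empty `X`-source:
`(m − |t|) + 0 + |t|`; a proper `Y`-source: `0 + 0 + |t| < m`). -/
theorem lval_le_and_iff (o : Opt m) : lval o ≤ m ∧ (lval o = m ↔ o.1 ⊆ Xs m) := by
  have e1 : lqf m o = if o.1 ⊆ Xs m ∧ o.1 ≠ ∅ then m - (o.1).card else 0 := rfl
  have e3 : lz m o = if o.1 = ∅ then 1 else 0 := rfl
  unfold lval
  rcases mem_optSet.mp o.2 with hX | ⟨hY, hpos, hlt⟩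
  · have hle : (o.1).card ≤ m := (Finset.card_le_card hX).trans (by rw [WedgePair.card_Xset])
    by_cases h0 : o.1 = ∅
    · rw [e1, e3, if_neg (fun h => h.2 h0), if_pos h0, h0, Finset.card_empty]
      exact ⟨by omega, ⟨fun _ => Finset.empty_subset _, fun _ => by omega⟩⟩
    · rw [e1, e3, if_pos ⟨hX, h0⟩, if_neg h0]
      exact ⟨by omega, ⟨fun _ => hX, fun _ => by omega⟩⟩
  · have h0 : o.1 ≠ ∅ := fun h => by rw [h, Finset.card_empty] at hpos; omega
    have hnX : ¬ o.1 ⊆ Xs m := fun hX =>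
      h0 (eq_empty_of_disjoint (WedgePair.disjoint_X_iff_subset_Y.mpr hY) (WedgePair.disjoint_Y_iff_subset_X.mpr hX))
    rw [e1, e3, if_neg (fun h => hnX h.1), if_neg h0]
    exact ⟨by omega, ⟨fun h => absurd h (by omega), fun h => absurd h hnX⟩⟩

/-- the local quantities sum to `q_f(f) + m·z(f) + k(f)`. -/
lemma sum_lval (f : Fin n → Opt m) : ∑ i, lval (f i) = qff f + m * zf f + kf f := by
  simp only [lval, qff, zf, kf, Finset.sum_add_distrib, Finset.mul_sum]

/-- a canonical source has at most `m` letters, so option data has degree `≤ mn`. -/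
lemma kf_le (f : Fin n → Opt m) : kf f ≤ m * n := by
  have h : ∀ i, ((f i).1).card ≤ m := fun i => by
    have := (lval_le_and_iff (f i)).1
    unfold lval at this
    omega
  calc kf f = ∑ i, ((f i).1).card := rfl
    _ ≤ ∑ _i : Fin n, m := Finset.sum_le_sum fun i _ => h i
    _ = m * n := by rw [Finset.sum_const, Finset.card_univ, Fintype.card_fin, smul_eq_mul, mul_comm]

/-- **a degree-`k` class reaches the TOP block `mn − k` iff every block of its option data is an `X`-subset.** -/
theorem mem_Fset_top_iff {k : ℕ} {f : Fin n → Opt m} :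
    f ∈ Fset m n k (m * n - k) ↔ kf f = k ∧ ∀ i, (f i).1 ⊆ Xs m := by
  have hle : ∀ i ∈ (Finset.univ : Finset (Fin n)), lval (f i) ≤ m := fun i _ => (lval_le_and_iff (f i)).1
  have hmn : ∑ _i : Fin n, m = m * n := by rw [Finset.sum_const, Finset.card_univ, Fintype.card_fin, smul_eq_mul, mul_comm]
  have hsum : qff f + m * zf f + kf f ≤ m * n := by
    rw [← sum_lval, ← hmn]
    exact Finset.sum_le_sum hle
  have hiff : qff f + m * zf f + kf f = m * n ↔ ∀ i, (f i).1 ⊆ Xs m := by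
    rw [← sum_lval, ← hmn, Finset.sum_eq_sum_iff_of_le hle]
    exact ⟨fun h i => (lval_le_and_iff (f i)).2.mp (h i (Finset.mem_univ i)),
      fun h i _ => (lval_le_and_iff (f i)).2.mpr (h i)⟩
  rw [mem_Fset]
  constructor
  · rintro ⟨hkf, j, hj, hq⟩
    have h2 : m * j ≤ m * zf f := Nat.mul_le_mul_left m hj
    exact ⟨hkf, hiff.mp (le_antisymm hsum (by omega))⟩
  · rintro ⟨hkf, hX⟩
    have h := hiff.mpr hX
    exact ⟨hkf, zf f, le_rfl, by omega⟩

/-- the canonical source map is injective on option data. -/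
lemma src_injective : Function.Injective (src (m := m) (n := n)) := fun f f' h =>
  funext fun i => Subtype.ext (congr_fun (glue_injective (show glue (fun i => (f i).1) = glue (fun i => (f' i).1) from h)) i)

/-- option data with prescribed `X`-blocks: the blocks of a monomial inside `XX`, as canonical sources. -/
def optOfX (S : Finset (Fin ((m + m) * n))) (hS : S ⊆ XX m n) (i : Fin n) : Opt m :=
  ⟨pb m n i S, mem_optSet.mpr (Or.inl (by
    have h := pb_mono hS i
    rwa [XX_eq_glue, pb_glue] at h))⟩

/-- **THE TOP BLOCK'S CLASSES ↔ THE `k`-SUBSETS OF THE `X`-LETTERS** (`f ↦ src f`). -/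
theorem map_src_Fset_top (k : ℕ) :
    (Fset m n k (m * n - k)).map ⟨src, src_injective⟩ = (XX m n).powersetCard k := by
  ext S
  rw [Finset.mem_map, Finset.mem_powersetCard]
  constructor
  · rintro ⟨f, hf, rfl⟩
    obtain ⟨hk, hX⟩ := mem_Fset_top_iff.mp hf
    exact ⟨by rw [Function.Embedding.coeFn_mk, src_eq_glue, XX_eq_glue, glue_subset_glue_iff]; exact hX,
      by rw [Function.Embedding.coeFn_mk, ← kf_eq_card_src, hk]⟩
  · rintro ⟨hS, hc⟩
    have hX : ∀ i, pb m n i S ⊆ Xs m := fun i => by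
      have h := pb_mono hS i
      rwa [XX_eq_glue, pb_glue] at h
    refine ⟨optOfX S hS, mem_Fset_top_iff.mpr ⟨?_, fun i => hX i⟩, ?_⟩
    · rw [kf_eq_card_src]
      show (glue fun i => pb m n i S).card = k
      rw [glue_pb, hc]
    · show glue (fun i => pb m n i S) = S
      exact glue_pb S

/-- so **`|Fset m n k (mn − k)| = C(mn, k)`**. -/
theorem card_Fset_top (k : ℕ) : (Fset m n k (m * n - k)).card = (m * n).choose k := by
  rw [← Finset.card_map ⟨src, src_injective⟩, map_src_Fset_top, Finset.card_powersetCard, card_XX_eq_card_YY, card_YY]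

/-! ## §2. The bottom block `q = 0`: all blocks have `q`-part `0`; `|Fset m n k 0| = C(mn, k)` -/

/-- **a canonical source has `q`-part `0` iff it is the top collapse `X` or a `Y`-subset** (`∅` included). -/
theorem lqf_eq_zero_iff (o : Opt m) : lqf m o = 0 ↔ o.1 = Xs m ∨ o.1 ⊆ Ys m := by
  have e1 : lqf m o = if o.1 ⊆ Xs m ∧ o.1 ≠ ∅ then m - (o.1).card else 0 := rfl
  rw [e1]
  constructor
  · intro h
    by_cases hc : o.1 ⊆ Xs m ∧ o.1 ≠ ∅
    · rw [if_pos hc] at h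
      exact Or.inl (Finset.eq_of_subset_of_card_le hc.1 (by rw [WedgePair.card_Xset]; omega))
    · rcases mem_optSet.mp o.2 with hX | ⟨hY, -⟩
      · have h0 : o.1 = ∅ := by by_contra h0; exact hc ⟨hX, h0⟩
        exact Or.inr (by rw [h0]; exact Finset.empty_subset _)
      · exact Or.inr hY
  · rintro (hX | hY)
    · rw [hX]; split_ifs <;> simp [WedgePair.card_Xset]
    · by_cases h0 : o.1 = ∅
      · rw [if_neg (fun h => h.2 h0)]
      · rw [if_neg (fun h => h0 (eq_empty_of_disjoint (WedgePair.disjoint_X_iff_subset_Y.mpr hY)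
          (WedgePair.disjoint_Y_iff_subset_X.mpr h.1)))]

/-- **a degree-`k` class reaches the BOTTOM block `0` iff every block of its option data has `q`-part `0`** (`m ≥ 1`). -/
theorem mem_Fset_zero_iff {k : ℕ} {f : Fin n → Opt m} :
    f ∈ Fset m n k 0 ↔ kf f = k ∧ ∀ i, lqf m (f i) = 0 := by
  rw [mem_Fset]
  refine and_congr Iff.rfl ⟨?_, fun h => ⟨0, Nat.zero_le _, ?_⟩⟩
  · rintro ⟨j, -, hq⟩ i
    have h0 : ∑ i, lqf m (f i) = 0 := by show qff f = 0; omega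
    exact (Finset.sum_eq_zero_iff.mp h0) i (Finset.mem_univ i)
  · rw [mul_zero, add_zero, eq_comm]
    exact Finset.sum_eq_zero fun i _ => h i

variable (m) in
/-- replace the top collapse `X` by `Y` (the other letter sets unchanged). -/
def toY (t : Finset (Fin (m + m))) : Finset (Fin (m + m)) := if t = Xs m then Ys m else t

/-- `toY` preserves the number of letters. -/
lemma card_toY (t : Finset (Fin (m + m))) : (toY m t).card = t.card := by
  unfold toY
  split_ifs with h
  · rw [h, WedgePair.card_Xset, WedgePair.card_Yset]
  · rfl

/-- `Y` itself is not a canonical source (`m ≥ 1`). -/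
lemma Ys_not_mem_optSet (hm : 1 ≤ m) : Ys m ∉ optSet m := by
  intro h
  rcases mem_optSet.mp h with hX | ⟨-, -, hlt⟩
  · have h0 := eq_empty_of_disjoint (WedgePair.disjoint_X_iff_subset_Y.mpr subset_rfl) (WedgePair.disjoint_Y_iff_subset_X.mpr hX)
    have hc := WedgePair.card_Yset m
    rw [h0, Finset.card_empty] at hc
    omega
  · rw [WedgePair.card_Yset] at hlt
    omega

/-- `toY` is injective on the canonical sources (`m ≥ 1`). -/
lemma toY_injective (hm : 1 ≤ m) {o o' : Opt m} (h : toY m o.1 = toY m o'.1) : o = o' := by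
  apply Subtype.ext
  have hY := Ys_not_mem_optSet (m := m) hm
  unfold toY at h
  by_cases h1 : o.1 = Xs m
  · by_cases h2 : o'.1 = Xs m
    · rw [h1, h2]
    · rw [if_pos h1, if_neg h2] at h
      have h3 := o'.2
      rw [← h] at h3
      exact absurd h3 hY
  · by_cases h2 : o'.1 = Xs m
    · rw [if_neg h1, if_pos h2] at h
      have h3 := o.2
      rw [h] at h3
      exact absurd h3 hY
    · rwa [if_neg h1, if_neg h2] at h

/-- on a source of `q`-part `0`, `toY` lands inside `Y`. -/
lemma toY_subset_Ys {o : Opt m} (h : lqf m o = 0) : toY m o.1 ⊆ Ys m := by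
  unfold toY
  rcases (lqf_eq_zero_iff o).mp h with hX | hY
  · rw [if_pos hX]
  · split_ifs
    · exact subset_rfl
    · exact hY

/-- the `Y`-MONOMIAL of option data: glue the blocks after `X ↦ Y`. -/
def glueY (f : Fin n → Opt m) : Finset (Fin ((m + m) * n)) := glue fun i => toY m (f i).1

/-- it is injective (`m ≥ 1`). -/
lemma glueY_injective (hm : 1 ≤ m) : Function.Injective (glueY (m := m) (n := n)) :=
  fun _ _ h => funext fun i => toY_injective hm (congr_fun (glue_injective h) i)

/-- option data with prescribed `Y`-blocks: the blocks of a monomial inside `YY`, with a full block `Y` read as the top collapse `X`. -/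
def optOfY (S : Finset (Fin ((m + m) * n))) (hS : S ⊆ YY m n) (i : Fin n) : Opt m :=
  if h : pb m n i S = Ys m then oTop m else
    ⟨pb m n i S, mem_optSet.mpr (by
      have hY : pb m n i S ⊆ Ys m := by
        have h' := pb_mono hS i
        rwa [YY, pb_glue] at h'
      by_cases h0 : pb m n i S = ∅
      · exact Or.inl (by rw [h0]; exact Finset.empty_subset _)
      · refine Or.inr ⟨hY, Nat.pos_of_ne_zero fun hc => h0 (Finset.card_eq_zero.mp hc), ?_⟩
        have hle : (pb m n i S).card ≤ m := (Finset.card_le_card hY).trans (by rw [WedgePair.card_Yset])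
        have hne : (pb m n i S).card ≠ m := fun hc =>
          h (Finset.eq_of_subset_of_card_le hY (by rw [WedgePair.card_Yset, hc]))
        omega)⟩

/-- the blocks of `optOfY`, after `X ↦ Y`, are the blocks of `S`; each has `q`-part `0`. -/
lemma toY_optOfY (hm : 1 ≤ m) (S : Finset (Fin ((m + m) * n))) (hS : S ⊆ YY m n) (i : Fin n) :
    toY m (optOfY S hS i).1 = pb m n i S ∧ lqf m (optOfY S hS i) = 0 := by
  unfold optOfY
  by_cases h : pb m n i S = Ys m
  · rw [dif_pos h]
    refine ⟨by rw [show (oTop m).1 = Xs m from rfl, toY, if_pos rfl, h], (lqf_eq_zero_iff _).mpr (Or.inl rfl)⟩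
  · rw [dif_neg h]
    have hY : pb m n i S ⊆ Ys m := by
      have h' := pb_mono hS i
      rwa [YY, pb_glue] at h'
    have hX : pb m n i S ≠ Xs m := fun e => by
      have h0 := eq_empty_of_disjoint (WedgePair.disjoint_X_iff_subset_Y.mpr hY)
        (WedgePair.disjoint_Y_iff_subset_X.mpr (fun x hx => by rw [e] at hx; exact hx))
      have hc := WedgePair.card_Xset m
      rw [show WedgePair.Xset m = Xs m from rfl, ← e, h0, Finset.card_empty] at hc
      omega
    exact ⟨by simp only [toY, if_neg hX], (lqf_eq_zero_iff _).mpr (Or.inr hY)⟩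

/-- **THE BOTTOM BLOCK'S CLASSES ↔ THE `k`-SUBSETS OF THE `Y`-LETTERS** (`f ↦ glueY f`; `m ≥ 1`). -/
theorem map_glueY_Fset_zero (hm : 1 ≤ m) (k : ℕ) :
    (Fset m n k 0).map ⟨glueY, glueY_injective hm⟩ = (YY m n).powersetCard k := by
  ext S
  rw [Finset.mem_map, Finset.mem_powersetCard]
  constructor
  · rintro ⟨f, hf, rfl⟩
    obtain ⟨hk, h0⟩ := mem_Fset_zero_iff.mp hf
    refine ⟨?_, ?_⟩
    · rw [Function.Embedding.coeFn_mk, glueY, YY, glue_subset_glue_iff]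
      exact fun i => toY_subset_Ys (h0 i)
    · rw [Function.Embedding.coeFn_mk, glueY, card_glue, ← hk, kf]
      exact Finset.sum_congr rfl fun i _ => card_toY _
  · rintro ⟨hS, hc⟩
    have hb := fun i => toY_optOfY hm S hS i
    have e : (fun i => toY m (optOfY S hS i).1) = fun i => pb m n i S := funext fun i => (hb i).1
    refine ⟨optOfY S hS, mem_Fset_zero_iff.mpr ⟨?_, fun i => (hb i).2⟩, ?_⟩
    · show ∑ i, ((optOfY S hS i).1).card = k
      rw [← hc, card_eq_sum_card_pb S]
      exact Finset.sum_congr rfl fun i _ => by rw [← (hb i).1, card_toY]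
    · show glue (fun i => toY m (optOfY S hS i).1) = S
      rw [e]
      exact glue_pb S

/-- so **`|Fset m n k 0| = C(mn, k)`** (`m ≥ 1`). -/
theorem card_Fset_zero (hm : 1 ≤ m) (k : ℕ) : (Fset m n k 0).card = (m * n).choose k := by
  rw [← Finset.card_map ⟨glueY, glueY_injective hm⟩, map_glueY_Fset_zero hm, Finset.card_powersetCard, card_YY]

/-! ## §3. THE RANKS OF THE TWO EXTREME BLOCKS, every `m ≥ 1`, `n`, `k` -/

/-- **THE BOTTOM BLOCK, UNIFORM IN `n` AND `m`**: for every field, every `m ≥ 1`, `n`, `k` and `a, c ≠ 0`, the `q = 0` block of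
`θ ↦ θ ∧ F` on `⋀^k K^{(m+m)n}` has rank `C(mn, k)` (the `9, 36, 84` opening the pre-registered `m = 3`, `n = 3` rows; the
`15, 28, 45 = C(2n, 2)` opening the surface rows of `WedgeSurfacePowersPerQRank.perq_rows_two`, in that file's own layout). -/
theorem finrank_range_blockProj_wedge_pairBox_zero (hm : 1 ≤ m) {a c : K} (ha : a ≠ 0) (hc : c ≠ 0) (k : ℕ) :
    finrank K (LinearMap.range (blockProj K m n 0 ∘ₗ wedge K (Fin ((m + m) * n)) k (pairBox K (m := m) (n := n) a c))) =
      (m * n).choose k := by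
  rw [finrank_range_blockProj_wedge_pairBox_eq_card K hm ha hc, card_Fset_zero hm]

/-- **THE TOP BLOCK, UNIFORM IN `n` AND `m`**: the `q = mn − k` block of `θ ↦ θ ∧ F` on `⋀^k K^{(m+m)n}` has rank `C(mn, k)` too
(`m ≥ 1`, `a, c ≠ 0`; for `k > mn` both sides are `0`). -/
theorem finrank_range_blockProj_wedge_pairBox_top (hm : 1 ≤ m) {a c : K} (ha : a ≠ 0) (hc : c ≠ 0) (k : ℕ) :
    finrank K (LinearMap.range (blockProj K m n (m * n - k) ∘ₗ
        wedge K (Fin ((m + m) * n)) k (pairBox K (m := m) (n := n) a c))) = (m * n).choose k := by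
  rw [finrank_range_blockProj_wedge_pairBox_eq_card K hm ha hc, card_Fset_top]

/-! ## §5. As arithmetic of the enumerator (§4 = the companion leaf `WedgePointPairPowersPerQExtremeOnto.lean`) -/

/-- **`genCount m n k 0 = C(mn, k)`** (`m ≥ 1`): the `u⁰`-column of `G_{m,n}` is `(1 + t)^{mn}`, by the bijection with the
`k`-subsets of the `Y`-letters (not by the generating function). -/
theorem genCount_zero (hm : 1 ≤ m) (n k : ℕ) : FormulaN.Uniform.genCount m n k 0 = (m * n).choose k := by
  rw [← card_Fset (n := n) hm, card_Fset_zero hm]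

/-- **`genCount m n k (mn − k) = C(mn, k)`** (`m ≥ 1`). -/
theorem genCount_top (hm : 1 ≤ m) (n k : ℕ) : FormulaN.Uniform.genCount m n k (m * n - k) = (m * n).choose k := by
  rw [← card_Fset (n := n) hm, card_Fset_top]

/-- the openings of the rows of record: `m = 3`, `n = 3`: `9, 36, 84`; surfaces (`m = 2`) `n = 3, 4, 5`, degree `2`: `15, 28, 45`. -/
theorem genCount_zero_rows :
    (FormulaN.Uniform.genCount 3 3 1 0, FormulaN.Uniform.genCount 3 3 2 0, FormulaN.Uniform.genCount 3 3 3 0) = (9, 36, 84) ∧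
    (FormulaN.Uniform.genCount 2 3 2 0, FormulaN.Uniform.genCount 2 4 2 0, FormulaN.Uniform.genCount 2 5 2 0) = (15, 28, 45) := by
  simp only [genCount_zero (show 1 ≤ 3 by norm_num), genCount_zero (show 1 ≤ 2 by norm_num)]
  decide

end Summit.Ventures.HSemireg.Wedge.PairPowers
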